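import Mathlib
import HarnessLib
import Summits.Ventures.LatticeQCDFlow.Exactness.SelfTunedFlowChoiceBias

/-!
# LatticeQCDFlow / Exactness — LEARNING ON THE JOB, IX: SOFT GATING IS BIASED TOO — mixing two exact samplers with a weight read off the
# current configuration (a confidence score, an acceptance-rate estimate, a sector indicator smoothed) keeps `π` only if the weight is
# blind to where the two samplers differ

HONEST FRAMING: exact (Metropolis-corrected) sampling algorithms for lattice gauge theory;
figures of merit are autocorrelation/cost numbers at stated couplings and volumes; no
continuum-physics claim.

Venture `LatticeQCDFlow` (cell pub-lqcd), topic `Exactness`, FANOUT row 30 (lean-1 GEN-44, theme LEARNING ON THE JOB).  The soft version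
of `SelfTunedFlowChoiceBias` (which is the case `λ = 1_S`).  NEW WORK of the cell; no definition is introduced, nothing is cited as a fact.
Tree inputs: `SelfTunedFlowChoiceBias` (`lintegral_apply_eq_of_invariant`, the two-point witness `selfTuned_not_invariant`).

## Setting
A target `π`; two Markov kernels `P₀`, `P₁` each exact for `π` (two flow samplers, before ∕ after retraining; a flow sampler and HMC); a
measurable GATE `λ : Ω → [0, 1]` read off the current configuration.  THE SOFT-GATED SAMPLER, def-free: any `K` with
`K(x, B) = λ(x)P₁(x, B) + (1 − λ(x))P₀(x, B)` (hypothesis `hK`).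

## Results (no `sorry`)
* §1 `softGate_apply_univ` ∕ `softGate_isMarkovKernel`; `softGate_bind_apply` — `(μK)(B) = ∫ λP₁(·, B) dμ + ∫ (1 − λ)P₀(·, B) dμ`.
* §2 **`softGate_bind_apply_add`** — THE DEFECT IDENTITY (`P₁` exact): `(πK)(B) + ∫ (1 − λ)P₁(·, B) dπ = π(B) + ∫ (1 − λ)P₀(·, B) dπ`;
  mirrored (`P₀` exact): **`softGate_bind_apply_add'`** `(πK)(B) + ∫ λP₀(·, B) dπ = π(B) + ∫ λP₁(·, B) dπ`.  Exact iff the `λ`-weighted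
  (resp. `(1 − λ)`-weighted) target is transported identically by the two kernels.
* §3 **`softGate_bind_apply_eq_of_const`** — a CONSTANT gate (or one drawn independently of the configuration) is exact: a fixed mixture
  of exact kernels; `softGate_bind_apply_eq_of_eq` — identical constituents are exact for any gate.
* §4 **`softGate_indicator_not_invariant`** — the hard gate `λ = 1_{{true}}` on the two-point witness of `SelfTunedFlowChoiceBias` is a
  soft-gated sampler and is NOT exact (`1/2 ↦ 7/12`): no general repair short of making the gate blind (§3) or pricing it in the ratio
  (`IMHStateDependentMoveChoice` for the jump ∕ stay dichotomy, the Hastings form of `SelfTunedFlowChoiceBias` §4 for flows).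
-/

namespace Summit.Ventures.LatticeQCDFlow.Exactness

open MeasureTheory ProbabilityTheory
open scoped _root_.ENNReal

variable {Ω : Type*} [MeasurableSpace Ω] {π : Measure Ω} {lam : Ω → ℝ≥0∞}

/-! ## §1 The soft-gated kernel -/

/-- `K(x, Ω) = λ(x) + (1 − λ(x)) = 1`. [ours, bookkeeping] -/
theorem softGate_apply_univ (hl1 : ∀ x, lam x ≤ 1) (P₀ P₁ K : Kernel Ω Ω) [IsMarkovKernel P₀] [IsMarkovKernel P₁]
    (hK : ∀ (x : Ω) {B : Set Ω}, MeasurableSet B → K x B = lam x * P₁ x B + (1 - lam x) * P₀ x B) (x : Ω) : K x Set.univ = 1 := by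
  rw [hK x MeasurableSet.univ, measure_univ, measure_univ, mul_one, mul_one, add_tsub_cancel_of_le (hl1 x)]

/-- The soft-gated kernel is Markov. [ours, bookkeeping] -/
theorem softGate_isMarkovKernel (hl1 : ∀ x, lam x ≤ 1) (P₀ P₁ K : Kernel Ω Ω) [IsMarkovKernel P₀] [IsMarkovKernel P₁]
    (hK : ∀ (x : Ω) {B : Set Ω}, MeasurableSet B → K x B = lam x * P₁ x B + (1 - lam x) * P₀ x B) : IsMarkovKernel K :=
  ⟨fun x => ⟨softGate_apply_univ hl1 P₀ P₁ K hK x⟩⟩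

/-- **`(μK)(B) = ∫ λP₁(·, B) dμ + ∫ (1 − λ)P₀(·, B) dμ`.** [ours] -/
theorem softGate_bind_apply (hl : Measurable lam) (P₀ P₁ K : Kernel Ω Ω)
    (hK : ∀ (x : Ω) {B : Set Ω}, MeasurableSet B → K x B = lam x * P₁ x B + (1 - lam x) * P₀ x B) (μ : Measure Ω) {B : Set Ω}
    (hB : MeasurableSet B) : (μ.bind K) B = ∫⁻ x, lam x * P₁ x B ∂μ + ∫⁻ x, (1 - lam x) * P₀ x B ∂μ := by
  rw [Measure.bind_apply hB (Kernel.aemeasurable _)]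
  simp_rw [hK _ hB]
  exact lintegral_add_left (hl.mul (Kernel.measurable_coe P₁ hB)) _

/-! ## §2 The defect identities -/

/-- Splitting an exact kernel's action along the gate: `π(B) = ∫ λP(·, B) dπ + ∫ (1 − λ)P(·, B) dπ`. [ours, bookkeeping] -/
theorem invariant_split_gate (hl : Measurable lam) (hl1 : ∀ x, lam x ≤ 1) (P : Kernel Ω Ω) (hP : Kernel.Invariant P π) {B : Set Ω}
    (hB : MeasurableSet B) : π B = ∫⁻ x, lam x * P x B ∂π + ∫⁻ x, (1 - lam x) * P x B ∂π := by
  have hm : Measurable fun x => lam x * P x B := hl.mul (Kernel.measurable_coe P hB)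
  rw [← lintegral_add_left hm, ← lintegral_apply_eq_of_invariant P hP hB]
  refine lintegral_congr fun x => ?_
  rw [← add_mul, add_tsub_cancel_of_le (hl1 x), one_mul]

/-- **THE DEFECT IDENTITY** (`P₁` exact): `(πK)(B) + ∫ (1 − λ)P₁(·, B) dπ = π(B) + ∫ (1 − λ)P₀(·, B) dπ`. [ours] -/
theorem softGate_bind_apply_add (hl : Measurable lam) (hl1 : ∀ x, lam x ≤ 1) (P₀ P₁ K : Kernel Ω Ω) (hP₁ : Kernel.Invariant P₁ π)
    (hK : ∀ (x : Ω) {B : Set Ω}, MeasurableSet B → K x B = lam x * P₁ x B + (1 - lam x) * P₀ x B) {B : Set Ω}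
    (hB : MeasurableSet B) :
    (π.bind K) B + ∫⁻ x, (1 - lam x) * P₁ x B ∂π = π B + ∫⁻ x, (1 - lam x) * P₀ x B ∂π := by
  rw [softGate_bind_apply hl P₀ P₁ K hK π hB, invariant_split_gate hl hl1 P₁ hP₁ hB]
  ring

/-- **THE DEFECT IDENTITY, MIRRORED** (`P₀` exact): `(πK)(B) + ∫ λP₀(·, B) dπ = π(B) + ∫ λP₁(·, B) dπ`. [ours] -/
theorem softGate_bind_apply_add' (hl : Measurable lam) (hl1 : ∀ x, lam x ≤ 1) (P₀ P₁ K : Kernel Ω Ω) (hP₀ : Kernel.Invariant P₀ π)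
    (hK : ∀ (x : Ω) {B : Set Ω}, MeasurableSet B → K x B = lam x * P₁ x B + (1 - lam x) * P₀ x B) {B : Set Ω}
    (hB : MeasurableSet B) :
    (π.bind K) B + ∫⁻ x, lam x * P₀ x B ∂π = π B + ∫⁻ x, lam x * P₁ x B ∂π := by
  rw [softGate_bind_apply hl P₀ P₁ K hK π hB, invariant_split_gate hl hl1 P₀ hP₀ hB]
  ring

/-! ## §3 Blind gates are exact -/

/-- **A CONSTANT GATE IS EXACT**: `λ ≡ c ≤ 1`, both constituents exact ⇒ `(πK)(B) = π(B)`. [ours] -/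
theorem softGate_bind_apply_eq_of_const {c : ℝ≥0∞} (hc1 : c ≤ 1) (P₀ P₁ K : Kernel Ω Ω) (hP₀ : Kernel.Invariant P₀ π)
    (hP₁ : Kernel.Invariant P₁ π) (hK : ∀ (x : Ω) {B : Set Ω}, MeasurableSet B → K x B = c * P₁ x B + (1 - c) * P₀ x B)
    {B : Set Ω} (hB : MeasurableSet B) : (π.bind K) B = π B := by
  rw [softGate_bind_apply measurable_const P₀ P₁ K hK π hB, lintegral_const_mul' _ _ (ne_top_of_le_ne_top ENNReal.one_ne_top hc1),
    lintegral_const_mul' _ _ (ne_top_of_le_ne_top ENNReal.one_ne_top tsub_le_self), lintegral_apply_eq_of_invariant P₁ hP₁ hB,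
    lintegral_apply_eq_of_invariant P₀ hP₀ hB, ← add_mul, add_tsub_cancel_of_le hc1, one_mul]

/-- … as invariance. [ours] -/
theorem softGate_invariant_of_const {c : ℝ≥0∞} (hc1 : c ≤ 1) (P₀ P₁ K : Kernel Ω Ω) (hP₀ : Kernel.Invariant P₀ π)
    (hP₁ : Kernel.Invariant P₁ π) (hK : ∀ (x : Ω) {B : Set Ω}, MeasurableSet B → K x B = c * P₁ x B + (1 - c) * P₀ x B) :
    Kernel.Invariant K π := by
  show π.bind K = π
  ext B hB
  exact softGate_bind_apply_eq_of_const hc1 P₀ P₁ K hP₀ hP₁ hK hB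

/-- **IDENTICAL CONSTITUENTS ARE EXACT FOR ANY GATE.** [ours] -/
theorem softGate_bind_apply_eq_of_eq (hl : Measurable lam) (hl1 : ∀ x, lam x ≤ 1) (P K : Kernel Ω Ω) (hP : Kernel.Invariant P π)
    (hK : ∀ (x : Ω) {B : Set Ω}, MeasurableSet B → K x B = lam x * P x B + (1 - lam x) * P x B) {B : Set Ω}
    (hB : MeasurableSet B) : (π.bind K) B = π B := by
  rw [softGate_bind_apply hl P P K hK π hB, ← invariant_split_gate hl hl1 P hP hB]

/-! ## §4 The hard gate of the two-point witness is a soft gate: not exact -/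

section SoftGateWitness

variable {q q₁ : Measure Bool} {w : Bool → ℝ}

/-- **SOFT GATING IS NOT EXACT IN GENERAL**: with `λ = 1_{{true}}` (the indicator gate), `P₀` the uniform-flow sampler and `P₁` the
perfect-flow sampler of the two-point witness, every soft-gated kernel is a self-tuned kernel, and `π` is not invariant. [ours] -/
theorem softGate_indicator_not_invariant (hq : ∀ b, q {b} = ENNReal.ofReal 2⁻¹) (hwf : w false = 1) (hwt : w true = 2)
    (hq₁f : q₁ {false} = ENNReal.ofReal 3⁻¹) [IsProbabilityMeasure q₁] (P₀ P₁ : Kernel Bool Bool)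
    (hP₀ : ∀ (x : Bool) {B : Set Bool}, MeasurableSet B → P₀ x B =
      ∫⁻ y in B, imhAcceptE w x y ∂q + (1 - imhAcceptMass q w x) * B.indicator 1 x)
    (hP₁ : ∀ (x : Bool) {B : Set Bool}, MeasurableSet B → P₁ x B =
      ∫⁻ y in B, imhAcceptE (fun _ : Bool => (3 / 2 : ℝ)) x y ∂q₁ + (1 - imhAcceptMass q₁ (fun _ : Bool => (3 / 2 : ℝ)) x) * B.indicator 1 x)
    (K : Kernel Bool Bool)
    (hK : ∀ (x : Bool) {B : Set Bool}, MeasurableSet B →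
      K x B = ({true} : Set Bool).indicator 1 x * P₁ x B + (1 - ({true} : Set Bool).indicator 1 x) * P₀ x B) :
    ¬ Kernel.Invariant K (q.withDensity fun y => ENNReal.ofReal (w y)) := by
  refine selfTuned_not_invariant hq hwf hwt hq₁f P₀ P₁ hP₀ hP₁ K (fun x hx B hB => ?_) (fun x hx B hB => ?_)
  · rw [hK x hB, Set.indicator_of_mem hx, Pi.one_apply, one_mul, tsub_self, zero_mul, add_zero]
  · rw [hK x hB, Set.indicator_of_notMem hx, zero_mul, zero_add, tsub_zero, one_mul]

end SoftGateWitness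

end Summit.Ventures.LatticeQCDFlow.Exactness
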